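import Literature.Computability.Cryptography.HallgrenClassGroupXgcdFP
import Literature.Computability.Cryptography.HallgrenClassGroupHowellFP
import Literature.Computability.Complexity.CodeFPStrings
import HarnessLib

/-!
# Hallgren 2005 / class numbers under GRH — programming step P13: modular arithmetic in `CodeFP`
# (powers by repeated squaring, Euler's criterion, powers in a quadratic extension, inverses, CRT)

Topic `Literature/Computability/Cryptography`; proof companion of `HallgrenClassGroup.lean`
(named fact `Hallgren2005_classNumber_qsolvable_of_GRH`). Definitions and theorems; no named fact.
The arithmetic kernels of the classical sampler of random forms (square roots modulo the sampled
first coefficient): the bits of a number (`strBitsC`), **modular powers by repeated squaring**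
(`powModStep`, `powMod_fold`, `powModC` — Shor 1997, §3 p. 9 / Arora–Barak 2009, §1.3), powers in
the quadratic extension `(ℤ/m)[ω]/(ω² − n)` on pairs of residues (`qmul`, `qpowStep`, `qpow_fold`,
`qpowModC` — the arithmetic of Cipolla's algorithm), the modular inverse (`invModC`, from the
extended Euclidean algorithm `ClFP.natGcdABC`) and the Chinese remainder combination (`crt2`,
`crt2_mod_fst/snd`, `crt2C`). The modulus is guarded by `HowellFP.gN m = max m 1`, so that every
value is a residue and the folds are honestly polynomially bounded.

## References

* P. W. Shor, SIAM J. Comput. 26 (1997), §3 p. 9 (modular exponentiation by repeated squaring) [Shor1997].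
* S. Arora, B. Barak, *Computational Complexity: A Modern Approach*, CUP 2009, §1.3 [AroraBarak2009].
* M. Cipolla, *Un metodo per la risoluzione della congruenza di secondo grado*, 1903 [folklore].
-/

noncomputable section

namespace Literature.Computability.Cryptography.Hallgren2005

namespace ArithFP

open _root_.Computability Literature.Computability.Complexity Literature.Computability.Complexity.CodeFP Polynomial ClFP HowellFP

/-! ### The bits of a number -/

/-- A string as the list of its symbols (so that folds over bits apply). [folklore] -/
theorem strBitsC : CodeFP strE (rawE bitE) (fun s => s) := by
  have hitem : CodeFP (pairE strE natE) bitE (fun t => t.1.getD t.2 false) := strGetDNat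
  have h := (map hitem).comp ((CodeFP.id strE).pair (urange.comp strLength))
  refine h.congr fun s => ?_
  simp only [id]
  refine List.ext_getElem (by simp) fun i h1 h2 => ?_
  rw [List.getElem_map, List.getElem_range, List.getD_eq_getElem?_getD, List.getElem?_eq_getElem (by simpa using h2), Option.getD_some]

/-- The bits of `n`, least significant first. [folklore] -/
def bits (n : ℕ) : List Bool := natE n

/-- `bits` on codes. [folklore] -/
theorem bitsC : CodeFP natE (rawE bitE) bits := (strBitsC.comp strOfNat).congr fun _ => rfl

/-- **The value of the bit list**: `n = ∑ bits[i] 2^i`, in Horner form over the list. [folklore] -/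
theorem foldr_bits (n : ℕ) : (bits n).foldr (fun b acc => b.toNat + 2 * acc) 0 = n := by
  have key : ∀ l : List Bool, l.foldr (fun b acc => b.toNat + 2 * acc) 0 = bitsToNat l := by
    intro l; induction l with
    | nil => rfl
    | cons b l ih => rw [List.foldr_cons, ih, bitsToNat_cons]
  rw [key, bits, show natE n = encodeNat n from rfl, bitsToNat_encodeNat]

/-! ### Modular powers by repeated squaring -/

/-- One step on `(acc, base)` reading a bit: multiply if set, square the base. [cite: Shor1997, §3 p.9] -/
def powModStep (m : ℕ) (st : ℕ × ℕ) (b : Bool) : ℕ × ℕ :=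
  (if b then st.1 * st.2 % m else st.1, st.2 * st.2 % m)

/-- **The fold computes the power**: after the bits of `e`, `acc = a · x^e mod m`. [cite: Shor1997, §3 p.9] -/
theorem powMod_fold (m : ℕ) : ∀ (l : List Bool) (acc x : ℕ), acc < m → x < m →
    (l.foldl (powModStep m) (acc, x)).1 = acc * x ^ (l.foldr (fun b r => b.toNat + 2 * r) 0) % m ∧
      (l.foldl (powModStep m) (acc, x)).1 < m ∧ (l.foldl (powModStep m) (acc, x)).2 < m
  | [], acc, x, ha, hx => by simp [Nat.mod_eq_of_lt ha, ha, hx]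
  | b :: l, acc, x, ha, hx => by
    have hm : 0 < m := by omega
    rw [List.foldl_cons, List.foldr_cons]
    have hacc' : (powModStep m (acc, x) b).1 < m := by unfold powModStep; split_ifs <;> simp [Nat.mod_lt _ hm, ha]
    obtain ⟨h1, h2, h3⟩ := powMod_fold m l (powModStep m (acc, x) b).1 (x * x % m) hacc' (Nat.mod_lt _ hm)
    refine ⟨?_, h2, h3⟩
    rw [show powModStep m (acc, x) b = ((powModStep m (acc, x) b).1, x * x % m) from rfl, h1, Nat.mul_mod, ← Nat.pow_mod,
      pow_add, pow_mul, sq]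
    conv_rhs => rw [← mul_assoc, Nat.mul_mod]
    congr 2
    unfold powModStep
    cases b <;> simp [Nat.mod_mod_of_dvd]

/-- The modular power, guarded. [cite: Shor1997, §3 p.9] -/
def powMod (a e m : ℕ) : ℕ := a ^ e % m

/-- **Modular powers on codes**: `a^e mod M`, `M = max m 1`, from `(a, e, m)`.
[cite: Shor1997, §3 p.9; AroraBarak2009, §1.3] -/
theorem powModC : CodeFP (pairE natE (pairE natE natE)) natE (fun p => powMod p.1 p.2.1 (gN p.2.2)) := by
  -- context `(m, a, junk)`, items: bits of `e`, state `(acc, base)`; the modulus is guarded in the step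
  have hstep : CodeFP (pairE (pairE natE (pairE natE natE)) (pairE bitE (pairE natE natE))) (pairE natE natE)
      (fun t => powModStep (gN t.1.1) t.2.2 t.2.1) := by
    have hM := natMax.comp ((fst (pairE natE (pairE natE natE)) (pairE bitE (pairE natE natE))).fst'.pair (const _ (1 : ℕ)))
    have hr : CodeFP (pairE (pairE natE (pairE natE natE)) (pairE bitE (pairE natE natE))) (pairE bitE (pairE natE natE)) (fun t => t.2) := snd _ _
    have hb := hr.fst'
    have hacc := hr.snd'.fst'
    have hx := hr.snd'.snd'
    have hmul := natMod.comp ((natMul.comp (hacc.pair hx)).pair hM)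
    have hsq := natMod.comp ((natMul.comp (hx.pair hx)).pair hM)
    have h := (ite hb hmul hacc).pair hsq
    refine h.congr fun t => ?_
    unfold powModStep
    split_ifs <;> rfl
  have hinit : CodeFP (pairE natE (pairE natE natE)) (pairE natE natE) (fun c => (1 % gN c.1, c.2.1 % gN c.1)) := by
    have c1 : CodeFP (pairE natE (pairE natE natE)) natE (fun _ => (1 : ℕ)) := const _ (1 : ℕ)
    have hM := natMax.comp ((fst natE (pairE natE natE)).pair c1)
    have h0 := (natMod.comp (c1.pair hM)).pair (natMod.comp ((snd natE (pairE natE natE)).fst'.pair hM))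
    refine h0.congr fun c => ?_
    rfl
  have h := foldl (σ := ℕ × ℕ × ℕ) (α := Bool) (β := ℕ × ℕ) (eσ := pairE natE (pairE natE natE)) (eα := bitE)
    (eβ := pairE natE natE) (step := fun c b st => powModStep (gN c.1) st b) (init := fun c => (1 % gN c.1, c.2.1 % gN c.1)) hstep hinit
    (C 2 * X + C 6) (fun c l₁ l₂ => by
      obtain ⟨M, a, _⟩ := c
      have hM : 0 < gN M := gN_pos M
      obtain ⟨-, hb1, hb2⟩ := powMod_fold (gN M) l₁ (1 % gN M) (a % gN M) (Nat.mod_lt _ hM) (Nat.mod_lt _ hM)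
      simp only [eval_add, eval_mul, eval_C, eval_X, pairE_apply, length_boolPair, length_natE]
      have e1 : l₁.foldl (fun st b => powModStep (gN M) st b) (1 % gN M, a % gN M) = l₁.foldl (powModStep (gN M)) (1 % gN M, a % gN M) := rfl
      rw [e1]
      have hMs : (gN M).size ≤ M.size + 1 := by
        unfold gN; rcases Nat.le_total M 1 with h | h
        · rw [max_eq_right h]; simp
        · rw [max_eq_left h]; omega
      have h1 := Nat.size_le_size hb1.le
      have h2 := Nat.size_le_size hb2.le
      omega)
  have hctx : CodeFP (pairE natE (pairE natE natE)) (pairE natE (pairE natE natE)) (fun p => (p.2.2, p.1, 0)) :=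
    (snd _ _).snd'.pair ((fst _ _).pair (const _ (0 : ℕ)))
  have hrun := h.comp (hctx.pair (bitsC.comp (snd _ _).fst'))
  refine hrun.fst'.congr fun p => ?_
  obtain ⟨a, e, m⟩ := p
  have hM : 0 < gN m := gN_pos m
  obtain ⟨h1, -, -⟩ := powMod_fold (gN m) (bits e) (1 % gN m) (a % gN m) (Nat.mod_lt _ hM) (Nat.mod_lt _ hM)
  have e1 : (bits e).foldl (fun st b => powModStep (gN m) st b) (1 % gN m, a % gN m) = (bits e).foldl (powModStep (gN m)) (1 % gN m, a % gN m) := rfl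
  dsimp only
  rw [e1, h1, foldr_bits, powMod, Nat.mod_mul_mod, one_mul, ← Nat.pow_mod]

/-! ### Powers in the quadratic extension `(ℤ/m)[ω]/(ω² − n)` on pairs of residues -/

/-- Multiplication of `u + v ω` by `u' + v' ω` with `ω² = n`, on residues `mod m`. [folklore] -/
def qmul (n m : ℕ) (x y : ℕ × ℕ) : ℕ × ℕ := ((x.1 * y.1 + x.2 * y.2 * n) % m, (x.1 * y.2 + x.2 * y.1) % m)

/-- One step of the power on `(acc, base)`. [folklore] -/
def qpowStep (n m : ℕ) (st : (ℕ × ℕ) × (ℕ × ℕ)) (b : Bool) : (ℕ × ℕ) × (ℕ × ℕ) :=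
  (if b then qmul n m st.1 st.2 else st.1, qmul n m st.2 st.2)

/-- The power `x^e` in the extension, by the bits of `e`. [folklore] -/
def qpow (n m : ℕ) (x : ℕ × ℕ) (e : ℕ) : ℕ × ℕ := ((bits e).foldl (qpowStep n m) ((1 % m, 0), (x.1 % m, x.2 % m))).1

/-- Components of `qmul` are residues. [folklore] -/
theorem qmul_lt {n m : ℕ} (hm : 0 < m) (x y : ℕ × ℕ) : (qmul n m x y).1 < m ∧ (qmul n m x y).2 < m :=
  ⟨Nat.mod_lt _ hm, Nat.mod_lt _ hm⟩

/-- The fold keeps residues. [folklore] -/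
theorem qpow_fold_lt {n m : ℕ} (hm : 0 < m) : ∀ (l : List Bool) (st : (ℕ × ℕ) × (ℕ × ℕ)),
    st.1.1 < m → st.1.2 < m → st.2.1 < m → st.2.2 < m →
      (l.foldl (qpowStep n m) st).1.1 < m ∧ (l.foldl (qpowStep n m) st).1.2 < m ∧
        (l.foldl (qpowStep n m) st).2.1 < m ∧ (l.foldl (qpowStep n m) st).2.2 < m
  | [], st, h1, h2, h3, h4 => ⟨h1, h2, h3, h4⟩
  | b :: l, st, h1, h2, h3, h4 => by
    rw [List.foldl_cons]
    refine qpow_fold_lt hm l _ ?_ ?_ (qmul_lt hm _ _).1 (qmul_lt hm _ _).2 <;> unfold qpowStep <;> split_ifs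
    exacts [(qmul_lt hm _ _).1, h1, (qmul_lt hm _ _).2, h2]

/-- `qmul n m` on codes (input `((n, m), x, y)`, `m` guarded). [folklore] -/
theorem qmulC : CodeFP (pairE (pairE natE natE) (pairE (pairE natE natE) (pairE natE natE))) (pairE natE natE)
    (fun t => qmul t.1.1 (gN t.1.2) t.2.1 t.2.2) := by
  have hc : CodeFP (pairE (pairE natE natE) (pairE (pairE natE natE) (pairE natE natE))) (pairE natE natE) (fun t => t.1) := fst _ _
  have hr : CodeFP (pairE (pairE natE natE) (pairE (pairE natE natE) (pairE natE natE))) (pairE (pairE natE natE) (pairE natE natE)) (fun t => t.2) := snd _ _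
  have hn := hc.fst'
  have hM := natMax.comp (hc.snd'.pair (const _ (1 : ℕ)))
  have hx1 := hr.fst'.fst'; have hx2 := hr.fst'.snd'; have hy1 := hr.snd'.fst'; have hy2 := hr.snd'.snd'
  have h1 := natMod.comp ((natAdd.comp ((natMul.comp (hx1.pair hy1)).pair (natMul.comp ((natMul.comp (hx2.pair hy2)).pair hn)))).pair hM)
  have h2 := natMod.comp ((natAdd.comp ((natMul.comp (hx1.pair hy2)).pair (natMul.comp (hx2.pair hy1)))).pair hM)
  have h := h1.pair h2
  refine h.congr fun t => ?_
  rfl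

/-- **Powers in the quadratic extension on codes**: `qpow n M x e` from `((n, m), x, e)`, `M = max m 1`.
[cite: AroraBarak2009, §1.3] -/
theorem qpowModC : CodeFP (pairE (pairE natE natE) (pairE (pairE natE natE) natE)) (pairE natE natE)
    (fun t => qpow t.1.1 (gN t.1.2) t.2.1 t.2.2) := by
  -- fold context: `((n, m), x)`; state `(acc, base)`
  have hstep : CodeFP (pairE (pairE (pairE natE natE) (pairE natE natE)) (pairE bitE (pairE (pairE natE natE) (pairE natE natE))))
      (pairE (pairE natE natE) (pairE natE natE)) (fun t => qpowStep t.1.1.1 (gN t.1.1.2) t.2.2 t.2.1) := by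
    have hc : CodeFP (pairE (pairE (pairE natE natE) (pairE natE natE)) (pairE bitE (pairE (pairE natE natE) (pairE natE natE)))) (pairE natE natE)
        (fun t => t.1.1) := (fst _ _).fst'
    have hr : CodeFP (pairE (pairE (pairE natE natE) (pairE natE natE)) (pairE bitE (pairE (pairE natE natE) (pairE natE natE))))
        (pairE bitE (pairE (pairE natE natE) (pairE natE natE))) (fun t => t.2) := snd _ _
    have hb := hr.fst'
    have hacc := hr.snd'.fst'
    have hbase := hr.snd'.snd'
    have hmul := qmulC.comp (hc.pair (hacc.pair hbase))
    have hsq := qmulC.comp (hc.pair (hbase.pair hbase))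
    have h := (ite hb hmul hacc).pair hsq
    refine h.congr fun t => ?_
    unfold qpowStep
    split_ifs <;> rfl
  have hinit : CodeFP (pairE (pairE natE natE) (pairE natE natE)) (pairE (pairE natE natE) (pairE natE natE))
      (fun c => ((1 % gN c.1.2, 0), (c.2.1 % gN c.1.2, c.2.2 % gN c.1.2))) := by
    have hM := natMax.comp ((fst (pairE natE natE) (pairE natE natE)).snd'.pair (const _ (1 : ℕ)))
    have hx := snd (pairE natE natE) (pairE natE natE)
    have c0 : CodeFP (pairE (pairE natE natE) (pairE natE natE)) natE (fun _ => (0 : ℕ)) := const _ (0 : ℕ)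
    have c1 : CodeFP (pairE (pairE natE natE) (pairE natE natE)) natE (fun _ => (1 : ℕ)) := const _ (1 : ℕ)
    have h0 := ((natMod.comp (c1.pair hM)).pair c0).pair ((natMod.comp (hx.fst'.pair hM)).pair (natMod.comp (hx.snd'.pair hM)))
    refine h0.congr fun c => ?_
    rfl
  have h := foldl (σ := (ℕ × ℕ) × (ℕ × ℕ)) (α := Bool) (β := (ℕ × ℕ) × (ℕ × ℕ)) (eσ := pairE (pairE natE natE) (pairE natE natE)) (eα := bitE)
    (eβ := pairE (pairE natE natE) (pairE natE natE)) (step := fun c b st => qpowStep c.1.1 (gN c.1.2) st b)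
    (init := fun c => ((1 % gN c.1.2, 0), (c.2.1 % gN c.1.2, c.2.2 % gN c.1.2))) hstep hinit
    (C 4 * X + C 20) (fun c l₁ l₂ => by
      obtain ⟨⟨n, m⟩, x⟩ := c
      have hM : 0 < gN m := gN_pos m
      have e1 : l₁.foldl (fun st b => qpowStep n (gN m) st b) ((1 % gN m, 0), (x.1 % gN m, x.2 % gN m)) =
          l₁.foldl (qpowStep n (gN m)) ((1 % gN m, 0), (x.1 % gN m, x.2 % gN m)) := rfl
      rw [e1]
      obtain ⟨h1, h2, h3, h4⟩ := qpow_fold_lt (n := n) hM l₁ ((1 % gN m, 0), (x.1 % gN m, x.2 % gN m)) (Nat.mod_lt _ hM) hM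
        (Nat.mod_lt _ hM) (Nat.mod_lt _ hM)
      simp only [eval_add, eval_mul, eval_C, eval_X, pairE_apply, length_boolPair, length_natE]
      have hMs : (gN m).size ≤ m.size + 1 := by
        unfold gN; rcases Nat.le_total m 1 with h | h
        · rw [max_eq_right h]; simp
        · rw [max_eq_left h]; omega
      have s1 := Nat.size_le_size h1.le; have s2 := Nat.size_le_size h2.le
      have s3 := Nat.size_le_size h3.le; have s4 := Nat.size_le_size h4.le
      omega)
  have hin : CodeFP (pairE (pairE natE natE) (pairE (pairE natE natE) natE)) (pairE (pairE natE natE) (pairE natE natE)) (fun t => (t.1, t.2.1)) :=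
    (fst _ _).pair (snd _ _).fst'
  have hrun := h.comp (hin.pair (bitsC.comp (snd _ _).snd'))
  refine hrun.fst'.congr fun t => ?_
  have e1 : (bits t.2.2).foldl (fun st b => qpowStep t.1.1 (gN t.1.2) st b) ((1 % gN t.1.2, 0), t.2.1.1 % gN t.1.2, t.2.1.2 % gN t.1.2) =
      (bits t.2.2).foldl (qpowStep t.1.1 (gN t.1.2)) ((1 % gN t.1.2, 0), t.2.1.1 % gN t.1.2, t.2.1.2 % gN t.1.2) := rfl
  dsimp only
  rw [e1, qpow]

/-! ### The modular inverse and the Chinese remainder combination -/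

/-- The inverse of `a` modulo `m` (when coprime): `gcdA a m mod m`. [folklore] -/
def invMod (a m : ℕ) : ℕ := ((Nat.gcdA a m) % (m : ℤ)).toNat

/-- The inverse as an element of `ZMod m`. [folklore] -/
theorem natCast_invMod {a m : ℕ} (hm : 0 < m) : ((invMod a m : ℕ) : ZMod m) = (Nat.gcdA a m : ZMod m) := by
  have hm0 : (0 : ℤ) < m := by exact_mod_cast hm
  rw [invMod, ← Int.cast_natCast, Int.toNat_of_nonneg (Int.emod_nonneg _ hm0.ne'), ZMod.intCast_mod]

/-- **`a · invMod a m = 1` in `ZMod m`** for `a, m` coprime. [folklore] -/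
theorem mul_invMod_eq_one {a m : ℕ} (h : Nat.Coprime a m) (hm : 0 < m) : ((a : ℕ) : ZMod m) * (invMod a m : ℕ) = 1 := by
  rw [natCast_invMod hm]
  have hbez := Nat.gcd_eq_gcd_ab a m
  rw [Nat.Coprime.gcd_eq_one h] at hbez
  have := congrArg (fun z : ℤ => (z : ZMod m)) hbez
  push_cast at this
  rw [ZMod.natCast_self, zero_mul, add_zero] at this
  exact this.symm

/-- **`a · invMod a m ≡ 1 (mod m)`** for `a, m` coprime and `m > 1`. [folklore] -/
theorem mul_invMod_mod {a m : ℕ} (h : Nat.Coprime a m) (hm : 1 < m) : a * invMod a m % m = 1 := by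
  have h1 := mul_invMod_eq_one h (zero_lt_one.trans hm)
  have h2 : ((a * invMod a m : ℕ) : ZMod m) = ((1 : ℕ) : ZMod m) := by push_cast; exact h1
  rw [ZMod.natCast_eq_natCast_iff'] at h2
  rw [h2, Nat.mod_eq_of_lt hm]

/-- `invMod` on codes (`m` guarded). [folklore] -/
theorem invModC : CodeFP (pairE natE natE) natE (fun p => invMod p.1 (gN p.2)) := by
  have hM := natMax.comp ((snd natE natE).pair (const _ (1 : ℕ)))
  have hA := (natGcdABC.comp ((fst natE natE).pair hM)).snd'.fst'
  have hMi := intOfNat.comp hM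
  have hr := intSub.comp (hA.pair (intMul.comp (hMi.pair (intEDiv.comp (hA.pair hMi)))))
  have h := intToNat.comp hr
  refine h.congr fun p => ?_
  simp only [invMod, emod_eq_sub, gN]

/-- **The Chinese remainder combination** of `r₁ mod m₁` and `r₂ mod m₂` (`m₁, m₂` coprime):
`x = r₁ + m₁ ((r₂ + m₂ m₁ − r₁ mod m₂) · m₁⁻¹ mod m₂)`, returned with the modulus `m₁ m₂`. [folklore] -/
def crt2 (r₁ m₁ r₂ m₂ : ℕ) : ℕ × ℕ :=
  ((r₁ + m₁ * ((r₂ + m₂ * m₁ - r₁ % m₂) % m₂ * invMod (m₁ % m₂) m₂ % m₂)) % (m₁ * m₂), m₁ * m₂)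

/-- The combination is `r₁` modulo `m₁`. [folklore] -/
theorem crt2_mod_fst (r₁ m₁ r₂ m₂ : ℕ) (h1 : r₁ < m₁) : (crt2 r₁ m₁ r₂ m₂).1 % m₁ = r₁ := by
  rw [crt2]
  simp only
  rw [Nat.mod_mul_right_mod, Nat.add_mul_mod_self_left, Nat.mod_eq_of_lt h1]

/-- The combination is `r₂` modulo `m₂` (coprime moduli, `m₂ > 1`). [folklore] -/
theorem crt2_mod_snd (r₁ m₁ r₂ m₂ : ℕ) (hc : Nat.Coprime m₁ m₂) (hm : 1 < m₂) (h2 : r₂ < m₂) : (crt2 r₁ m₁ r₂ m₂).1 % m₂ = r₂ := by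
  have hm0 : 0 < m₂ := zero_lt_one.trans hm
  have hm1 : 0 < m₁ := by
    rcases Nat.eq_zero_or_pos m₁ with rfl | h
    · rw [Nat.coprime_zero_left] at hc; omega
    · exact h
  have hinv : ((m₁ : ℕ) : ZMod m₂) * (invMod (m₁ % m₂) m₂ : ℕ) = 1 := by
    have h := mul_invMod_eq_one (a := m₁ % m₂) (m := m₂) (by rw [Nat.Coprime, ← Nat.gcd_rec, Nat.gcd_comm]; exact hc) hm0
    rwa [ZMod.natCast_mod] at h
  rw [crt2]
  simp only
  rw [Nat.mod_mul_left_mod]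
  have hle : r₁ % m₂ ≤ r₂ + m₂ * m₁ := (Nat.mod_lt r₁ hm0).le.trans ((Nat.le_mul_of_pos_right _ hm1).trans (Nat.le_add_left _ _))
  have key : ((r₁ + m₁ * ((r₂ + m₂ * m₁ - r₁ % m₂) % m₂ * invMod (m₁ % m₂) m₂ % m₂) : ℕ) : ZMod m₂) = ((r₂ : ℕ) : ZMod m₂) := by
    push_cast [Nat.cast_sub hle, ZMod.natCast_mod, ZMod.natCast_self]
    linear_combination ((r₂ : ZMod m₂) - r₁) * hinv
  rw [ZMod.natCast_eq_natCast_iff'] at key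
  rw [key, Nat.mod_eq_of_lt h2]

/-- `crt2` on codes (both moduli guarded by `gN`). [folklore] -/
theorem crt2C : CodeFP (pairE (pairE natE natE) (pairE natE natE)) (pairE natE natE)
    (fun p => crt2 p.1.1 (gN p.1.2) p.2.1 (gN p.2.2)) := by
  have ha : CodeFP (pairE (pairE natE natE) (pairE natE natE)) (pairE natE natE) (fun t => t.1) := fst _ _
  have hb : CodeFP (pairE (pairE natE natE) (pairE natE natE)) (pairE natE natE) (fun t => t.2) := snd _ _
  have hr1 := ha.fst'; have hr2 := hb.fst'
  have hm1 := natMax.comp (ha.snd'.pair (const _ (1 : ℕ)))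
  have hm2 := natMax.comp (hb.snd'.pair (const _ (1 : ℕ)))
  have hinv := invModC.comp ((natMod.comp (hm1.pair hm2)).pair hm2)
  have hdiff := natMod.comp ((natSub.comp ((natAdd.comp (hr2.pair (natMul.comp (hm2.pair hm1)))).pair (natMod.comp (hr1.pair hm2)))).pair hm2)
  have hk := natMod.comp ((natMul.comp (hdiff.pair hinv)).pair hm2)
  have hprod := natMul.comp (hm1.pair hm2)
  have hx := natMod.comp ((natAdd.comp (hr1.pair (natMul.comp (hm1.pair hk)))).pair hprod)
  refine (hx.pair hprod).congr fun p => ?_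
  have hgg : gN (gN p.2.2) = gN p.2.2 := by unfold gN; omega
  simp only [crt2, gN] at hgg ⊢
  rw [hgg]

end ArithFP

end Literature.Computability.Cryptography.Hallgren2005

end
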